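import Literature.ModelTheory.ExponentialFields.DefinableBaire
import Literature.ModelTheory.ExponentialFields.OMinimalCellDecomposition
import Literature.ModelTheory.ExponentialFields.DefinabilityParams
import Mathlib.Data.Set.Card
import HarnessLib

/-!
# o-minimal structures are definably Baire

Topic `Literature/ModelTheory/ExponentialFields`.  Fornasiero–Servi, *Definably complete Baire
structures*, Fund. Math. 209 (2010), Examples 2.11: "The following are examples of definably
complete Baire structures. … Every o-minimal expansion of a field.  In fact, a nowhere dense
definable subset of `K` is finite, and definable families of finite sets are uniformly finite;
hence, the union of a definable increasing family of nowhere dense sets is finite, and can not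
coincide with the whole structure."  This file proves that argument for the notion
`FirstOrder.Language.IsDefinablyBaire` of `DefinableBaire.lean`, for an o-minimal structure on
a dense linear order without endpoints (`IsOMinimal`, `ModelTheoryPreds.lean`), using the
uniform finiteness theorem of `OMinimalCellDecomposition.lean`:

* `IsOMinimal.finite_of_isNowhereDense` — a nowhere dense definable subset of the line is finite;
* **`IsOMinimal.isDefinablyBaire`** — o-minimal structures are definably Baire.

Everything is proved; no definitions, no named facts.

## References

* A. Fornasiero, T. Servi, *Definably complete Baire structures*, Fund. Math. 209 (2010),
  Examples 2.11. [FornasieroServi2010]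
* L. van den Dries, *Tame topology and o-minimal structures* (1998), Ch. 3, (2.13) (uniform
  finiteness). [Dries1998]
-/

universe u v w

open Set FirstOrder FirstOrder.Language

namespace Literature.ModelTheory.ExponentialFields

variable {L : FirstOrder.Language.{u, v}} {M : Type w} [L.Structure M] [LinearOrder M]
  [DenselyOrdered M] [NoMinOrder M] [NoMaxOrder M] [TopologicalSpace M] [OrderTopology M]

omit [LinearOrder M] [DenselyOrdered M] [NoMinOrder M] [NoMaxOrder M] [TopologicalSpace M]
  [OrderTopology M] in
/-- The fibre `{x | (t, x) ∈ Y}` of a definable `Y ⊆ M²` is definable (as a set of `1`-tuples).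
[folklore] -/
theorem definable_fibre_pair {Y : Set (Fin 2 → M)} (hY : (univ : Set M).Definable L Y) (t : M) :
    (univ : Set M).Definable L {v : Fin 1 → M | (![t, v 0] : Fin 2 → M) ∈ Y} := by
  have hF : (univ : Set M).DefinableMap L fun v : Fin 1 → M => (![t, v 0] : Fin 2 → M) := by
    refine Fin.forall_fin_two.2 ⟨?_, ?_⟩
    · simpa using definableFun_const_params (L := L) (A := (univ : Set M)) (Fin 1) (mem_univ t)
    · simpa using definableFun_proj_params (L := L) (A := (univ : Set M)) (0 : Fin 1)
  exact hY.preimage_map hF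

omit [TopologicalSpace M] [OrderTopology M] [DenselyOrdered M] [NoMinOrder M] [NoMaxOrder M]
  [LinearOrder M] [L.Structure M] in
/-- `Fin.snoc` of a `1`-tuple is the pair. [folklore] -/
theorem snoc_fin_one_eq (x : Fin 1 → M) (r : M) : (Fin.snoc x r : Fin 2 → M) = ![x 0, r] := by
  funext i
  fin_cases i
  · rfl
  · rfl

/-- **In an o-minimal structure a nowhere dense definable subset of the line is finite**
(Fornasiero–Servi 2010, Examples 2.11: "a nowhere dense definable subset of `K` is finite"): an
infinite finite union of points and intervals contains an open interval, which is open and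
non-empty in the order topology of a dense order. [cite: FornasieroServi2010, Examples 2.11] -/
theorem _root_.FirstOrder.Language.IsOMinimal.finite_of_isNowhereDense (hO : L.IsOMinimal M)
    {S : Set M} (hS : (univ : Set M).Definable L {v : Fin 1 → M | v 0 ∈ S})
    (hnd : IsNowhereDense S) : S.Finite := by
  by_contra hinf
  have hfu : IsFiniteUnionOfIntervals {x | x ∈ S} := isFiniteUnionOfIntervals_setOf_params hO hS
  obtain ⟨a, b, hab, hsub⟩ := hfu.exists_Ioo_subset_of_infinite (by simpa using hinf)
  have h1 : Ioo a b ⊆ interior (closure S) :=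
    interior_maximal (fun x hx => subset_closure (hsub hx)) isOpen_Ioo
  obtain ⟨c, hc⟩ := exists_between hab
  have h2 := h1 hc
  rw [IsNowhereDense] at hnd
  rw [hnd] at h2
  exact h2

/-- **o-minimal structures are definably Baire** (Fornasiero–Servi 2010, Examples 2.11: "Every
o-minimal expansion of a field.  In fact, a nowhere dense definable subset of `K` is finite, and
definable families of finite sets are uniformly finite; hence, the union of a definable
increasing family of nowhere dense sets is finite, and can not coincide with the whole
structure"; here for any o-minimal structure on a dense linear order without endpoints, the
uniform finiteness being van den Dries' Ch. 3 (2.13)). [cite: FornasieroServi2010, Examples 2.11] -/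
theorem _root_.FirstOrder.Language.IsOMinimal.isDefinablyBaire [Nonempty M] (hO : L.IsOMinimal M)
    (hlt : (univ : Set M).Definable L {v : Fin 2 → M | v 0 < v 1}) : L.IsDefinablyBaire M := by
  classical
  intro Y hY hnd hinc
  -- the fibres are finite
  have hfin : ∀ t, {x | (![t, x] : Fin 2 → M) ∈ Y}.Finite := fun t =>
    hO.finite_of_isNowhereDense (S := {x | (![t, x] : Fin 2 → M) ∈ Y})
      (by simpa using definable_fibre_pair hY t) (hnd t)
  -- uniformly so
  obtain ⟨N, hN⟩ := CellDecomposition.uniformFiniteness hO hlt (m := 1) Y hY fun x => by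
    simpa only [snoc_fin_one_eq] using hfin (x 0)
  have hN' : ∀ t, {x | (![t, x] : Fin 2 → M) ∈ Y}.ncard ≤ N := fun t => by
    simpa only [snoc_fin_one_eq] using hN (fun _ => t)
  -- if the family covered `M`, `N + 1` points would lie in a single fibre
  by_contra hcov
  push Not at hcov
  haveI : Infinite M := NoMaxOrder.infinite
  obtain ⟨s, hs⟩ := Infinite.exists_subset_card_eq M (N + 1)
  have hsne : s.Nonempty := Finset.card_pos.1 (by omega)
  choose τ hτ using hcov
  set T : M := s.sup' hsne τ with hT
  have hsub : (s : Set M) ⊆ {x | (![T, x] : Fin 2 → M) ∈ Y} := fun x hx =>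
    hinc (τ x) T (Finset.le_sup' τ hx) (hτ x)
  have h1 : (s : Set M).ncard ≤ {x | (![T, x] : Fin 2 → M) ∈ Y}.ncard :=
    Set.ncard_le_ncard hsub (hfin T)
  rw [Set.ncard_coe_finset, hs] at h1
  exact absurd (h1.trans (hN' T)) (by omega)

end Literature.ModelTheory.ExponentialFields
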